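import Literature.NumberTheory.Rogawski1990.ArchimedeanTransfer               -- ★ `IsArchStablyConjH`, the endoscopic carriers `arch 2 Φ₂ × arch 1 Φ₁`
import Literature.NumberTheory.Rogawski1990.LocalTransferTransport            -- ★ `OrbitalMeasureFamily.transport`, `stableOrbitalIntegralRel_transport`
import Literature.NumberTheory.Automorphic.ArchCongruenceTransport            -- ★ p06: `formCongr` over the CM field, `archFormOf_formCongr`
import Literature.NumberTheory.Automorphic.ArchDiagonalTorus                    -- ★ D1′b: `circleDiagonal_mem_archLocal_diagonal`
import Literature.NumberTheory.Automorphic.ArchRankOneLimitFormulaGroup        -- ★ (R1G) p840661: `exists_tendsto_deriv_two_sin_smul_orbitalIntegral` (HC rank-one limit formula at a central point)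
import HarnessLib

/-!
# The ENDOSCOPIC diagonal congruence: `Φ₂ = c(Q₂)ᵀ · diag(½, −½) · Q₂`, `Q₂ = [[1,1],[1,−1]]`, putting `H_∞ = U(Φ₂)(L ⊗ ℝ) × U(Φ₁)(L ⊗ ℝ)` on a DIAGONAL 2-block where the torus stack
# and Harish-Chandra's rank-one limit formula (★ (R1G)) apply at EVERY place (ROAD-Sd, residual R3 «(S-c) central vanishing», first joint (R3-a); Rogawski 1990 §4.9, §14.3, p. 238)

Topic `NumberTheory/Automorphic`; namespace `Literature.NumberTheory.Automorphic.UnitaryGroup`.  THEOREMS ONLY (no `def`, no instance, no notation, no axiom, no named fact, no `sorry`).  Cell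
`pub/hodgecm-mathlib`, ENGINE T1 (crux H413 = `stmt-HodgeConjecture-24833`); floor-1 preparation, count-neutral, under the closer's row (S-c) `stub_Sc : ArchTransfersSingularOfCanonicalClosed` (LEDGER
`LEDGER-ROAD-Sd.v2.F0P3a-p02g10.md` residual R3 = `stub_ScCore` of the «SdArch» sketch; LEAD DESK WORD T8-53, F0P3a-plan (g9), 2026-09-01; census `CENSUS-R3-ScCentralVanishing.F0P3a-p02g10.md` 3fa90e6c (R3-a));
author F0P3a-p02 (g10).  Twin of ★ (T-d) FILE 1 §4 (`formCongr_quasiSplitFrame_diagonal`, `N = 3`) at `N = 2`, for the endoscopic group.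

WHY.  (S-c) [Rogawski1990 Lemma 14.5.2 (c), p. 238: «the limit formula for `H` implies `f′^H_v(γ₀) = 0`»] reads Harish-Chandra's limit formula AT THE CENTRE of the endoscopic `H_∞`, whose 2-block
`U(Φ₂)(L ⊗ ℝ)`, `Φ₂ = antidiag(1,1)`, is the quasi-split `U(1,1)` at EVERY complex place; the tree's rank-one limit formula ★ (R1G) `exists_tendsto_deriv_two_sin_smul_orbitalIntegral` is typed on the DIAGONAL
groups `U(σ diag a)(ℂ)` (`σ a` real, `σa₀·σa₁ < 0`) with the circle torus `circleDiagonal 2`, which is NOT a torus of `U(σ_wΦ₂)`.  The explicit rational congruence `Φ₂ = c(Q₂)ᵀ · diag(½,−½) · Q₂` (`x̄₀x₁ + x̄₁x₀ =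
½|x₀+x₁|² − ½|x₀−x₁|²`) makes `U(Φ₂)(L ⊗ ℝ) ≃ₜ* U(diag(½,−½))(L ⊗ ℝ)` a TERM (★ FILE 1), hence `H_∞ ≃ₜ* U(diag(½,−½))(L ⊗ ℝ) × U(Φ₁)(L ⊗ ℝ)`; central elements are fixed; stable conjugacy on `H_∞`
(componentwise, ★ `IsArchStablyConjH`) is carried; and per place the target 2-block is (R1G)'s carrier TOKEN FOR TOKEN, so (R1G) holds there BY NAME with `hreal`∕`hsgn` discharged (§4).

WHAT IS PROVED.
* §1 `det_quasiSplitFrameTwo` (`= −2`), `…_ne_zero`, **`formCongr_quasiSplitFrameTwo_diagonal`** (`c(Q₂)ᵀ · diag(½,−½) · Q₂ = Φ₂`), and the weight facts for `β₂ = (½, −½)`: `quasiSplitWeightsTwo_ne_zero`,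
  `cmConjRingHom_quasiSplitWeightsTwo`, `transpose_map_cmConjRingHom_diagonal_quasiSplitWeightsTwo`, `im_embedding_quasiSplitWeightsTwo_eq_zero`, `re_embedding_quasiSplitWeightsTwo`, **`re_embedding_quasiSplitWeightsTwo_mul_neg`**
  (`re σ_w β₀ · re σ_w β₁ < 0` at EVERY place = (R1G)'s `hsgn`).
* §2–§3 for ANY `H_∞`-level isomorphism `Ψ : U(Φ₂) × U(Φ₁) ≃ₜ* U(J) × U(Φ₁)` conjugating the 2-block by some `T ∈ GL₂(L ⊗ ℝ)` (`hΨ₁`) and fixing the `U(Φ₁)`-factor (`hΨ₂`) — e.g. `Ψ = Φ_{Q₂} × id`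
  (★ `ContinuousMulEquiv.prodCongr' (unitaryGroupOfFormCongrOfEq … (formCongr_map_mixedEmbedding_archFormOf_eq L (formCongr_quasiSplitFrameTwo_diagonal L))) (refl _)`, both hypotheses `rfl`):
  **`coe_endoCongr_fst_eq_of_coe_eq_map_smul_one`** (an element with rational SCALAR 2-block — the central `(ζ•1₂, u)` of (S-c) — keeps its 2-block), **`stableOrbitalIntegralRel_isStablyConjH_transport_endoCongr`**:
  `Φ^st_{(J, Φ₁)}(Ψ γ_H, f ∘ Ψ⁻¹; Ψ_* mH) = Φ^st_{H_∞}(γ_H, f; mH)` (★ `stableOrbitalIntegralRel_transport`, componentwise conjugacy).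
* §4 **`exists_tendsto_deriv_two_sin_smul_orbitalIntegral_archLocal_quasiSplitTwo`**: ★ (R1G) READ on `archLocal L 2 (diagonal β₂) w` at every complex place `w` (hypotheses discharged by §1) — HC's limit formula at the
  central points `z•1` of every local factor of the diagonalised endoscopic 2-block.
NOT HERE (census §2): the multi-place Fubini∕two-class bookkeeping on `H_∞` (R3-b), the iterated central limit formula (R3-c), the factor along the central curve (R3-d), compact-place flatness (R3-e), the assembly (R3-f);
the `ArchSmooth₂` transport along `Ψ` (FILE 4 pattern through `endoEmbArch ∘ Ψ⁻¹ = Ad((Q₂ ⊕ 1)⁻¹) ∘ endoEmbArch`, with (R3-b)).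
HONEST LABEL: HC_CM is proved only modulo the printed citations until rung 0 closes; this file is bookkeeping and pays nothing by itself.

## References
* [Rogawski1990] J. D. Rogawski, *Automorphic Representations of Unitary Groups in Three Variables*, Ann. of Math. Stud. 123 (1990), §4.9 p. 54 (`H = U(2) × U(1)` quasi-split, `Φ₂`), §14.3 p. 234 (`H_∞`),
  §14.5 Lemma 14.5.2 (c) + proof p. 238 («the limit formula for `H`»), §8.2 Prop. 8.2.1 p. 119.
* [Varadarajan1989] V. S. Varadarajan, *An Introduction to Harmonic Analysis on Semisimple Lie Groups* (1989), §6.4 Thm 22 (the rank-one limit formula behind (R1G)).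
* [PlatonovRapinchuk1994] V. Platonov, A. Rapinchuk, *Algebraic Groups and Number Theory* (1994), §2.3 (congruent hermitian forms have conjugate unitary groups).
-/

set_option autoImplicit false

noncomputable section

open MeasureTheory Measure Filter Topology NumberField NumberField.InfinitePlace NumberField.mixedEmbedding Set
open Literature.MeasureTheory.Group Literature.NumberTheory.Rogawski1990
open scoped Matrix MatrixGroups Matrix.Norms.Operator

namespace Literature.NumberTheory.Automorphic

namespace UnitaryGroup

/-! ## §1 The rational congruence `Φ₂ = c(Q₂)ᵀ · diag(½, −½) · Q₂` and the weights `β₂ = (½, −½)` -/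

section QuasiSplitTwo

variable (L : Type) [Field L] [NumberField L] [IsCMField L]

omit [NumberField L] [IsCMField L] in
/-- `det [[1,1],[1,−1]] = −2`. [cite: Rogawski1990, §4.9 p. 54] -/
theorem det_quasiSplitFrameTwo : Matrix.det !![(1 : L), 1; 1, -1] = -2 := by
  rw [Matrix.det_fin_two_of]
  norm_num

omit [IsCMField L] in
/-- `det [[1,1],[1,−1]] ≠ 0` (characteristic zero). [cite: Rogawski1990, §4.9 p. 54] -/
theorem det_quasiSplitFrameTwo_ne_zero : Matrix.det !![(1 : L), 1; 1, -1] ≠ 0 := by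
  rw [det_quasiSplitFrameTwo]
  norm_num

/-- **THE ENDOSCOPIC CONGRUENCE**: `c(Q₂)ᵀ · diag(½, −½) · Q₂ = Φ₂` (the antidiagonal unit form of the endoscopic 2-block ★ `IsArchNormPair` ∕ `ArchSmooth₂`), `Q₂ = [[1,1],[1,−1]]` RATIONAL:
`x̄₀x₁ + x̄₁x₀ = ½|x₀ + x₁|² − ½|x₀ − x₁|²`.  Hence `U(Φ₂)(L ⊗ ℝ) ≃ₜ* U(diag(½,−½))(L ⊗ ℝ)` is the TERM ★ `unitaryGroupOfFormCongrOfEq … (formCongr_map_mixedEmbedding_archFormOf_eq L (formCongr_quasiSplitFrameTwo_diagonal L))`.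
[cite: Rogawski1990, §4.9 p. 54] [cite: PlatonovRapinchuk1994, §2.3] -/
theorem formCongr_quasiSplitFrameTwo_diagonal :
    formCongr (cmConjRingHom L) (Matrix.GeneralLinearGroup.mkOfDetNeZero !![(1 : L), 1; 1, -1] (det_quasiSplitFrameTwo_ne_zero L))
        (Matrix.diagonal ![(2 : L)⁻¹, -(2 : L)⁻¹]) =
      Matrix.of fun i j : Fin 2 => if i.val + j.val + 1 = 2 then (1 : L) else 0 := by
  have hQ : ((Matrix.GeneralLinearGroup.mkOfDetNeZero !![(1 : L), 1; 1, -1] (det_quasiSplitFrameTwo_ne_zero L) : GL (Fin 2) L) :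
      Matrix (Fin 2) (Fin 2) L).map (cmConjRingHom L) = !![(1 : L), 1; 1, -1] := by
    rw [Matrix.GeneralLinearGroup.val_mkOfDetNeZero]
    ext i j
    fin_cases i <;> fin_cases j <;> simp
  rw [formCongr, hQ, Matrix.GeneralLinearGroup.val_mkOfDetNeZero]
  ext i j
  fin_cases i <;> fin_cases j <;> simp [Matrix.mul_apply, Fin.sum_univ_two, Matrix.diagonal] <;> ring

omit [NumberField L] [IsCMField L] in
/-- The weights `β₂ = (½, −½)` are non-zero (characteristic zero). [cite: Rogawski1990, §4.9 p. 54] -/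
theorem quasiSplitWeightsTwo_ne_zero [CharZero L] : ∀ i : Fin 2, (![(2 : L)⁻¹, -(2 : L)⁻¹]) i ≠ 0 := by
  intro i
  fin_cases i <;> simp

/-- `c β_i = β_i`: `diag(½, −½)` is `c`-hermitian. [cite: Rogawski1990, §4.9 p. 54] -/
theorem cmConjRingHom_quasiSplitWeightsTwo : ∀ i : Fin 2, cmConjRingHom L ((![(2 : L)⁻¹, -(2 : L)⁻¹]) i) = (![(2 : L)⁻¹, -(2 : L)⁻¹]) i := by
  intro i
  fin_cases i <;> simp [map_ofNat]

/-- `(c · diag β₂)ᵀ = diag β₂`. [cite: Rogawski1990, §4.9 p. 54] -/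
theorem transpose_map_cmConjRingHom_diagonal_quasiSplitWeightsTwo :
    ((Matrix.diagonal ![(2 : L)⁻¹, -(2 : L)⁻¹]).map (cmConjRingHom L))ᵀ = Matrix.diagonal ![(2 : L)⁻¹, -(2 : L)⁻¹] := by
  rw [Matrix.diagonal_map (map_zero _), Matrix.diagonal_transpose]
  congr 1
  funext i
  exact cmConjRingHom_quasiSplitWeightsTwo L i

omit [IsCMField L] in
/-- `σ_w β_i` is REAL at every complex embedding. [cite: Rogawski1990, §4.9 p. 54] -/
theorem im_embedding_quasiSplitWeightsTwo_eq_zero (w : {w : InfinitePlace L // IsComplex w}) :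
    ∀ i : Fin 2, (w.1.embedding ((![(2 : L)⁻¹, -(2 : L)⁻¹]) i)).im = 0 := by
  intro i
  fin_cases i <;> simp [map_inv₀, map_ofNat]

omit [IsCMField L] in
/-- The real parts: `re σ_w β₂ = (½, −½)`. [cite: Rogawski1990, §4.9 p. 54] -/
theorem re_embedding_quasiSplitWeightsTwo (w : {w : InfinitePlace L // IsComplex w}) (i : Fin 2) :
    (w.1.embedding ((![(2 : L)⁻¹, -(2 : L)⁻¹]) i)).re = (![(2 : ℝ)⁻¹, -(2 : ℝ)⁻¹]) i := by
  have h2 : w.1.embedding (2 : L) = ((2 : ℝ) : ℂ) := by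
    rw [map_ofNat, Complex.ofReal_ofNat]
  have hinv : w.1.embedding ((2 : L)⁻¹) = (((2 : ℝ)⁻¹ : ℝ) : ℂ) := by
    rw [map_inv₀, h2, Complex.ofReal_inv]
  fin_cases i
  · show (w.1.embedding ((2 : L)⁻¹)).re = (2 : ℝ)⁻¹
    rw [hinv, Complex.ofReal_re]
  · show (w.1.embedding (-(2 : L)⁻¹)).re = -(2 : ℝ)⁻¹
    rw [map_neg, hinv, ← Complex.ofReal_neg, Complex.ofReal_re]

omit [IsCMField L] in
/-- **EVERY complex place is a `(1,1)` place for `β₂`**: `re σ_w β₀ · re σ_w β₁ = −¼ < 0` — the hypothesis `hsgn` of ★ (R1G) `exists_tendsto_deriv_two_sin_smul_orbitalIntegral`.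
[cite: Rogawski1990, §4.9 p. 54; §8.2 p. 119] -/
theorem re_embedding_quasiSplitWeightsTwo_mul_neg (w : {w : InfinitePlace L // IsComplex w}) :
    (w.1.embedding ((![(2 : L)⁻¹, -(2 : L)⁻¹]) 0)).re * (w.1.embedding ((![(2 : L)⁻¹, -(2 : L)⁻¹]) 1)).re < 0 := by
  rw [re_embedding_quasiSplitWeightsTwo, re_embedding_quasiSplitWeightsTwo]
  simp only [Matrix.cons_val_zero, Matrix.cons_val_one]
  norm_num

end QuasiSplitTwo

/-! ## §2 An `H_∞`-level isomorphism `Ψ` conjugating the 2-block and fixing the `U(Φ₁)`-factor: central elements -/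

section Endo

variable (L : Type) [Field L] [NumberField L] [IsCMField L] {J : Matrix (Fin 2) (Fin 2) L} (T : GL (Fin 2) (mixedSpace L))
  (Ψ : (arch (↥(maximalRealSubfield L)) L (IsCMField.complexConj L) 2 (Matrix.of fun i j : Fin 2 => if i.val + j.val + 1 = 2 then (1 : L) else 0) ×
      arch (↥(maximalRealSubfield L)) L (IsCMField.complexConj L) 1 (Matrix.of fun i j : Fin 1 => if i.val + j.val + 1 = 1 then (1 : L) else 0)) ≃ₜ*
    (arch (↥(maximalRealSubfield L)) L (IsCMField.complexConj L) 2 J ×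
      arch (↥(maximalRealSubfield L)) L (IsCMField.complexConj L) 1 (Matrix.of fun i j : Fin 1 => if i.val + j.val + 1 = 1 then (1 : L) else 0)))
  (hΨ₁ : ∀ x, (((Ψ x).1 : arch (↥(maximalRealSubfield L)) L (IsCMField.complexConj L) 2 J) : GL (Fin 2) (mixedSpace L)) = T * (x.1 : GL (Fin 2) (mixedSpace L)) * T⁻¹)
  (hΨ₂ : ∀ x, (Ψ x).2 = x.2)

include hΨ₁ in
/-- **CENTRAL 2-BLOCKS ARE FIXED**: if the 2-block of `x` is a rational SCALAR `ζ•1₂ ⊗ 1` (the central `γ_H = (ζ•1₂, ζ•1₁)` of (S-c)), then `(Ψ x).1` has the SAME underlying matrix — `T (ζ•1 ⊗ 1) T⁻¹ = ζ•1 ⊗ 1`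
for every `T` (a scalar matrix is central in `GL₂(L ⊗ ℝ)`). With `hΨ₂` the whole element is unchanged. (For `Ψ = Φ_{Q₂} × id`, the TERM `ContinuousMulEquiv.prodCongr' (unitaryGroupOfFormCongrOfEq … (formCongr_map_mixedEmbedding_archFormOf_eq L
(formCongr_quasiSplitFrameTwo_diagonal L))) (ContinuousMulEquiv.refl _)`, both hypotheses hold by `rfl`.) [cite: Rogawski1990, §14.5 p. 238; §4.9 p. 55] -/
theorem coe_endoCongr_fst_eq_of_coe_eq_map_smul_one
    (x : arch (↥(maximalRealSubfield L)) L (IsCMField.complexConj L) 2 (Matrix.of fun i j : Fin 2 => if i.val + j.val + 1 = 2 then (1 : L) else 0) ×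
      arch (↥(maximalRealSubfield L)) L (IsCMField.complexConj L) 1 (Matrix.of fun i j : Fin 1 => if i.val + j.val + 1 = 1 then (1 : L) else 0))
    (γ : GL (Fin 2) L) {ζ : L} (hγ : (γ : Matrix (Fin 2) (Fin 2) L) = ζ • (1 : Matrix (Fin 2) (Fin 2) L))
    (hx : (x.1 : GL (Fin 2) (mixedSpace L)) = Matrix.GeneralLinearGroup.map (mixedEmbedding L) γ) :
    (((Ψ x).1 : arch (↥(maximalRealSubfield L)) L (IsCMField.complexConj L) 2 J) : GL (Fin 2) (mixedSpace L)) = (x.1 : GL (Fin 2) (mixedSpace L)) := by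
  rw [hΨ₁ x, hx]
  -- `γ ⊗ 1` is the scalar `(ζ ⊗ 1) • 1`, hence central
  have hsc : ((Matrix.GeneralLinearGroup.map (mixedEmbedding L) γ : GL (Fin 2) (mixedSpace L)) : Matrix (Fin 2) (Fin 2) (mixedSpace L)) =
      (mixedEmbedding L ζ) • (1 : Matrix (Fin 2) (Fin 2) (mixedSpace L)) := by
    show (γ : Matrix (Fin 2) (Fin 2) L).map (mixedEmbedding L) = _
    rw [hγ, Matrix.map_smul' , Matrix.map_one (mixedEmbedding L) (map_zero _) (map_one _)]
    · simp
  have hcomm : (T : Matrix (Fin 2) (Fin 2) (mixedSpace L)) * ((Matrix.GeneralLinearGroup.map (mixedEmbedding L) γ : GL (Fin 2) (mixedSpace L)) : Matrix (Fin 2) (Fin 2) (mixedSpace L)) =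
      ((Matrix.GeneralLinearGroup.map (mixedEmbedding L) γ : GL (Fin 2) (mixedSpace L)) : Matrix (Fin 2) (Fin 2) (mixedSpace L)) * (T : Matrix (Fin 2) (Fin 2) (mixedSpace L)) := by
    rw [hsc, Matrix.mul_smul, Matrix.smul_mul, Matrix.mul_one, Matrix.one_mul]
  apply Units.ext
  rw [Units.val_mul, Units.val_mul, hcomm, Matrix.mul_assoc, ← Units.val_mul, mul_inv_cancel, Units.val_one, Matrix.mul_one]

end Endo

/-! ## §3 Stable orbital integrals on `H_∞` under such a `Ψ` -/

section Stable

variable (L : Type) [Field L] [NumberField L] [IsCMField L] {J : Matrix (Fin 2) (Fin 2) L} (T : GL (Fin 2) (mixedSpace L))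
  (Ψ : (arch (↥(maximalRealSubfield L)) L (IsCMField.complexConj L) 2 (Matrix.of fun i j : Fin 2 => if i.val + j.val + 1 = 2 then (1 : L) else 0) ×
      arch (↥(maximalRealSubfield L)) L (IsCMField.complexConj L) 1 (Matrix.of fun i j : Fin 1 => if i.val + j.val + 1 = 1 then (1 : L) else 0)) ≃ₜ*
    (arch (↥(maximalRealSubfield L)) L (IsCMField.complexConj L) 2 J ×
      arch (↥(maximalRealSubfield L)) L (IsCMField.complexConj L) 1 (Matrix.of fun i j : Fin 1 => if i.val + j.val + 1 = 1 then (1 : L) else 0)))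
  (hΨ₁ : ∀ x, (((Ψ x).1 : arch (↥(maximalRealSubfield L)) L (IsCMField.complexConj L) 2 J) : GL (Fin 2) (mixedSpace L)) = T * (x.1 : GL (Fin 2) (mixedSpace L)) * T⁻¹)
  (hΨ₂ : ∀ x, (Ψ x).2 = x.2)
  [∀ a : arch (↥(maximalRealSubfield L)) L (IsCMField.complexConj L) 2 (Matrix.of fun i j : Fin 2 => if i.val + j.val + 1 = 2 then (1 : L) else 0) ×
      arch (↥(maximalRealSubfield L)) L (IsCMField.complexConj L) 1 (Matrix.of fun i j : Fin 1 => if i.val + j.val + 1 = 1 then (1 : L) else 0),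
    MeasurableSpace ((arch (↥(maximalRealSubfield L)) L (IsCMField.complexConj L) 2 (Matrix.of fun i j : Fin 2 => if i.val + j.val + 1 = 2 then (1 : L) else 0) ×
      arch (↥(maximalRealSubfield L)) L (IsCMField.complexConj L) 1 (Matrix.of fun i j : Fin 1 => if i.val + j.val + 1 = 1 then (1 : L) else 0)) ⧸
      Subgroup.centralizer ({a} : Set (arch (↥(maximalRealSubfield L)) L (IsCMField.complexConj L) 2 (Matrix.of fun i j : Fin 2 => if i.val + j.val + 1 = 2 then (1 : L) else 0) ×
        arch (↥(maximalRealSubfield L)) L (IsCMField.complexConj L) 1 (Matrix.of fun i j : Fin 1 => if i.val + j.val + 1 = 1 then (1 : L) else 0))))]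
  [∀ a : arch (↥(maximalRealSubfield L)) L (IsCMField.complexConj L) 2 (Matrix.of fun i j : Fin 2 => if i.val + j.val + 1 = 2 then (1 : L) else 0) ×
      arch (↥(maximalRealSubfield L)) L (IsCMField.complexConj L) 1 (Matrix.of fun i j : Fin 1 => if i.val + j.val + 1 = 1 then (1 : L) else 0),
    BorelSpace ((arch (↥(maximalRealSubfield L)) L (IsCMField.complexConj L) 2 (Matrix.of fun i j : Fin 2 => if i.val + j.val + 1 = 2 then (1 : L) else 0) ×
      arch (↥(maximalRealSubfield L)) L (IsCMField.complexConj L) 1 (Matrix.of fun i j : Fin 1 => if i.val + j.val + 1 = 1 then (1 : L) else 0)) ⧸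
      Subgroup.centralizer ({a} : Set (arch (↥(maximalRealSubfield L)) L (IsCMField.complexConj L) 2 (Matrix.of fun i j : Fin 2 => if i.val + j.val + 1 = 2 then (1 : L) else 0) ×
        arch (↥(maximalRealSubfield L)) L (IsCMField.complexConj L) 1 (Matrix.of fun i j : Fin 1 => if i.val + j.val + 1 = 1 then (1 : L) else 0))))]
  [∀ a : arch (↥(maximalRealSubfield L)) L (IsCMField.complexConj L) 2 J ×
      arch (↥(maximalRealSubfield L)) L (IsCMField.complexConj L) 1 (Matrix.of fun i j : Fin 1 => if i.val + j.val + 1 = 1 then (1 : L) else 0),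
    MeasurableSpace ((arch (↥(maximalRealSubfield L)) L (IsCMField.complexConj L) 2 J ×
      arch (↥(maximalRealSubfield L)) L (IsCMField.complexConj L) 1 (Matrix.of fun i j : Fin 1 => if i.val + j.val + 1 = 1 then (1 : L) else 0)) ⧸
      Subgroup.centralizer ({a} : Set (arch (↥(maximalRealSubfield L)) L (IsCMField.complexConj L) 2 J ×
        arch (↥(maximalRealSubfield L)) L (IsCMField.complexConj L) 1 (Matrix.of fun i j : Fin 1 => if i.val + j.val + 1 = 1 then (1 : L) else 0))))]
  [∀ a : arch (↥(maximalRealSubfield L)) L (IsCMField.complexConj L) 2 J ×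
      arch (↥(maximalRealSubfield L)) L (IsCMField.complexConj L) 1 (Matrix.of fun i j : Fin 1 => if i.val + j.val + 1 = 1 then (1 : L) else 0),
    BorelSpace ((arch (↥(maximalRealSubfield L)) L (IsCMField.complexConj L) 2 J ×
      arch (↥(maximalRealSubfield L)) L (IsCMField.complexConj L) 1 (Matrix.of fun i j : Fin 1 => if i.val + j.val + 1 = 1 then (1 : L) else 0)) ⧸
      Subgroup.centralizer ({a} : Set (arch (↥(maximalRealSubfield L)) L (IsCMField.complexConj L) 2 J ×
        arch (↥(maximalRealSubfield L)) L (IsCMField.complexConj L) 1 (Matrix.of fun i j : Fin 1 => if i.val + j.val + 1 = 1 then (1 : L) else 0))))]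

include hΨ₁ hΨ₂ in
/-- **`Φ^st` ON `H_∞` IS CARRIED BY `Ψ`**: `Φ^st_{(J, Φ₁)}(Ψ γ_H, f ∘ Ψ⁻¹; Ψ_* mH) = Φ^st_{H_∞}(γ_H, f; mH)` for every family `mH`, every `f` and `γ_H` — stable conjugacy on the endoscopic group is componentwise `GL`-conjugacy (★
`IsArchStablyConjH` ∕ ★ `IsStablyConjH`), intertwined by `Ψ` (first component conjugated by `T`, second fixed); ★ `stableOrbitalIntegralRel_transport`. [cite: Rogawski1990, §14.4 p. 237; §3.1 p. 19; §4.3 (4.3.1) p. 43] -/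
theorem stableOrbitalIntegralRel_isStablyConjH_transport_endoCongr
    (mH : OrbitalMeasureFamily (arch (↥(maximalRealSubfield L)) L (IsCMField.complexConj L) 2 (Matrix.of fun i j : Fin 2 => if i.val + j.val + 1 = 2 then (1 : L) else 0) ×
      arch (↥(maximalRealSubfield L)) L (IsCMField.complexConj L) 1 (Matrix.of fun i j : Fin 1 => if i.val + j.val + 1 = 1 then (1 : L) else 0)))
    (f : arch (↥(maximalRealSubfield L)) L (IsCMField.complexConj L) 2 (Matrix.of fun i j : Fin 2 => if i.val + j.val + 1 = 2 then (1 : L) else 0) ×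
      arch (↥(maximalRealSubfield L)) L (IsCMField.complexConj L) 1 (Matrix.of fun i j : Fin 1 => if i.val + j.val + 1 = 1 then (1 : L) else 0) → ℂ)
    (γH : arch (↥(maximalRealSubfield L)) L (IsCMField.complexConj L) 2 (Matrix.of fun i j : Fin 2 => if i.val + j.val + 1 = 2 then (1 : L) else 0) ×
      arch (↥(maximalRealSubfield L)) L (IsCMField.complexConj L) 1 (Matrix.of fun i j : Fin 1 => if i.val + j.val + 1 = 1 then (1 : L) else 0)) :
    stableOrbitalIntegralRel
        (G := arch (↥(maximalRealSubfield L)) L (IsCMField.complexConj L) 2 J ×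
          arch (↥(maximalRealSubfield L)) L (IsCMField.complexConj L) 1 (Matrix.of fun i j : Fin 1 => if i.val + j.val + 1 = 1 then (1 : L) else 0))
        (IsStablyConjH (conjMixed (↥(maximalRealSubfield L)) L (IsCMField.complexConj L)) (archFormOf L 2 J)
          (archFormOf L 1 (Matrix.of fun i j : Fin 1 => if i.val + j.val + 1 = 1 then (1 : L) else 0)))
        (mH.transport Ψ.toMulEquiv Ψ.continuous Ψ.symm.continuous) (f ∘ Ψ.symm) (Ψ γH) =
      stableOrbitalIntegralRel (IsArchStablyConjH L) mH f γH := by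
  -- `IsConj a b ↔ IsConj (T a T⁻¹) (T b T⁻¹)` in `GL₂`
  have hconjT : ∀ a b : GL (Fin 2) (mixedSpace L), IsConj a b ↔ IsConj (T * a * T⁻¹) (T * b * T⁻¹) := fun a b => by
    rw [isConj_iff, isConj_iff]
    constructor
    · rintro ⟨c, hc⟩
      refine ⟨T * c * T⁻¹, ?_⟩
      rw [← hc]
      group
    · rintro ⟨c, hc⟩
      refine ⟨T⁻¹ * c * T, ?_⟩
      have h2 : T⁻¹ * (c * (T * a * T⁻¹) * c⁻¹) * T = T⁻¹ * (T * b * T⁻¹) * T := by rw [hc]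
      calc T⁻¹ * c * T * a * (T⁻¹ * c * T)⁻¹ = T⁻¹ * (c * (T * a * T⁻¹) * c⁻¹) * T := by group
        _ = T⁻¹ * (T * b * T⁻¹) * T := h2
        _ = b := by group
  have hst : ∀ b b', IsArchStablyConjH L b b' ↔
      IsStablyConjH (conjMixed (↥(maximalRealSubfield L)) L (IsCMField.complexConj L)) (archFormOf L 2 J)
        (archFormOf L 1 (Matrix.of fun i j : Fin 1 => if i.val + j.val + 1 = 1 then (1 : L) else 0)) (Ψ.toMulEquiv b) (Ψ.toMulEquiv b') := fun b b' => by
    show (IsConj (b.1 : GL (Fin 2) (mixedSpace L)) (b'.1 : GL (Fin 2) (mixedSpace L)) ∧ IsConj (b.2 : GL (Fin 1) (mixedSpace L)) (b'.2 : GL (Fin 1) (mixedSpace L))) ↔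
      (IsConj (((Ψ b).1 : arch (↥(maximalRealSubfield L)) L (IsCMField.complexConj L) 2 J) : GL (Fin 2) (mixedSpace L))
          (((Ψ b').1 : arch (↥(maximalRealSubfield L)) L (IsCMField.complexConj L) 2 J) : GL (Fin 2) (mixedSpace L)) ∧
        IsConj (((Ψ b).2 : arch (↥(maximalRealSubfield L)) L (IsCMField.complexConj L) 1 _) : GL (Fin 1) (mixedSpace L))
          (((Ψ b').2 : arch (↥(maximalRealSubfield L)) L (IsCMField.complexConj L) 1 _) : GL (Fin 1) (mixedSpace L)))
    rw [hΨ₁ b, hΨ₁ b', hΨ₂ b, hΨ₂ b']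
    exact and_congr (hconjT _ _) Iff.rfl
  have hclassA : ∀ (a y y' : arch (↥(maximalRealSubfield L)) L (IsCMField.complexConj L) 2 J ×
      arch (↥(maximalRealSubfield L)) L (IsCMField.complexConj L) 1 (Matrix.of fun i j : Fin 1 => if i.val + j.val + 1 = 1 then (1 : L) else 0)), IsConj y y' →
      (IsStablyConjH (conjMixed (↥(maximalRealSubfield L)) L (IsCMField.complexConj L)) (archFormOf L 2 J)
          (archFormOf L 1 (Matrix.of fun i j : Fin 1 => if i.val + j.val + 1 = 1 then (1 : L) else 0)) a y ↔
        IsStablyConjH (conjMixed (↥(maximalRealSubfield L)) L (IsCMField.complexConj L)) (archFormOf L 2 J)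
          (archFormOf L 1 (Matrix.of fun i j : Fin 1 => if i.val + j.val + 1 = 1 then (1 : L) else 0)) a y') := fun a y y' hc => by
    obtain ⟨c, hc⟩ := isConj_iff.1 hc
    have h1 : IsConj (y.1 : GL (Fin 2) (mixedSpace L)) (y'.1 : GL (Fin 2) (mixedSpace L)) :=
      isConj_iff.2 ⟨(c.1 : GL (Fin 2) (mixedSpace L)), by rw [← hc]; rfl⟩
    have h2 : IsConj (y.2 : GL (Fin 1) (mixedSpace L)) (y'.2 : GL (Fin 1) (mixedSpace L)) :=
      isConj_iff.2 ⟨(c.2 : GL (Fin 1) (mixedSpace L)), by rw [← hc]; rfl⟩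
    exact ⟨fun h => ⟨h.1.trans h1, h.2.trans h2⟩, fun h => ⟨h.1.trans h1.symm, h.2.trans h2.symm⟩⟩
  have hclassB : ∀ (b y y' : arch (↥(maximalRealSubfield L)) L (IsCMField.complexConj L) 2 (Matrix.of fun i j : Fin 2 => if i.val + j.val + 1 = 2 then (1 : L) else 0) ×
      arch (↥(maximalRealSubfield L)) L (IsCMField.complexConj L) 1 (Matrix.of fun i j : Fin 1 => if i.val + j.val + 1 = 1 then (1 : L) else 0)), IsConj y y' →
      (IsArchStablyConjH L b y ↔ IsArchStablyConjH L b y') := fun b y y' hc => by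
    obtain ⟨c, hc⟩ := isConj_iff.1 hc
    have h1 : IsConj (y.1 : GL (Fin 2) (mixedSpace L)) (y'.1 : GL (Fin 2) (mixedSpace L)) :=
      isConj_iff.2 ⟨(c.1 : GL (Fin 2) (mixedSpace L)), by rw [← hc]; rfl⟩
    have h2 : IsConj (y.2 : GL (Fin 1) (mixedSpace L)) (y'.2 : GL (Fin 1) (mixedSpace L)) :=
      isConj_iff.2 ⟨(c.2 : GL (Fin 1) (mixedSpace L)), by rw [← hc]; rfl⟩
    exact ⟨fun h => ⟨h.1.trans h1, h.2.trans h2⟩, fun h => ⟨h.1.trans h1.symm, h.2.trans h2.symm⟩⟩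
  have h := stableOrbitalIntegralRel_transport
    (A := arch (↥(maximalRealSubfield L)) L (IsCMField.complexConj L) 2 J ×
      arch (↥(maximalRealSubfield L)) L (IsCMField.complexConj L) 1 (Matrix.of fun i j : Fin 1 => if i.val + j.val + 1 = 1 then (1 : L) else 0))
    (B := arch (↥(maximalRealSubfield L)) L (IsCMField.complexConj L) 2 (Matrix.of fun i j : Fin 2 => if i.val + j.val + 1 = 2 then (1 : L) else 0) ×
      arch (↥(maximalRealSubfield L)) L (IsCMField.complexConj L) 1 (Matrix.of fun i j : Fin 1 => if i.val + j.val + 1 = 1 then (1 : L) else 0))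
    Ψ.toMulEquiv Ψ.continuous Ψ.symm.continuous
    (IsStablyConjH (conjMixed (↥(maximalRealSubfield L)) L (IsCMField.complexConj L)) (archFormOf L 2 J)
      (archFormOf L 1 (Matrix.of fun i j : Fin 1 => if i.val + j.val + 1 = 1 then (1 : L) else 0)))
    (IsArchStablyConjH L) hst hclassA hclassB mH (f ∘ Ψ.symm) γH
  have hcomp : (f ∘ Ψ.symm) ∘ (Ψ.toMulEquiv : _ → _) = f := funext fun b => by
    show f (Ψ.symm (Ψ b)) = f b
    rw [ContinuousMulEquiv.symm_apply_apply]
  rw [hcomp] at h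
  exact h

end Stable

/-! ## §4 (R1G) on every local factor of the diagonalised endoscopic 2-block -/

section RankOne

variable (L : Type) [Field L] [NumberField L] [IsCMField L] (w : {w : InfinitePlace L // IsComplex w})

omit [IsCMField L] in
/-- **HARISH-CHANDRA'S RANK-ONE LIMIT FORMULA AT THE CENTRAL POINTS OF `U(σ_w diag(½,−½))(ℂ)` = the `w`-factor of the diagonalised endoscopic 2-block, AT EVERY COMPLEX PLACE `w`**: ★ (R1G)
`exists_tendsto_deriv_two_sin_smul_orbitalIntegral` BY NAME with `hreal`, `hsgn` discharged by §1 — `∃ C ≠ 0`, for every `f ∈ C¹_c(M₂(ℂ), E)` and `z ∈ S¹`: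
`∂_ψ[2 sin ψ · ∫ f(h·diag(ze^{iψ}, ze^{−iψ})·h⁻¹) dμ₂] → C • f(z•1)` (`ψ → 0`, `ψ ≠ 0`) and differentiability for `0 < |ψ| < 1`.  The carrier `unitaryGroupOfForm conj ((diagonal β₂).map σ_w)` IS
`archLocal L 2 (diagonal β₂) w` (definitionally). [cite: Varadarajan1989, §6.4 Thm 22] [cite: Rogawski1990, §8.2 p. 119; §14.5 p. 238] -/
theorem exists_tendsto_deriv_two_sin_smul_orbitalIntegral_archLocal_quasiSplitTwo {E : Type*} [NormedAddCommGroup E] [NormedSpace ℝ E] [CompleteSpace E]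
    [MeasurableSpace (unitaryGroupOfForm (starRingEnd ℂ) ((Matrix.diagonal ![(2 : L)⁻¹, -(2 : L)⁻¹]).map (w.1.embedding : L →+* ℂ)))]
    [BorelSpace (unitaryGroupOfForm (starRingEnd ℂ) ((Matrix.diagonal ![(2 : L)⁻¹, -(2 : L)⁻¹]).map (w.1.embedding : L →+* ℂ)))]
    (μ₂ : Measure (unitaryGroupOfForm (starRingEnd ℂ) ((Matrix.diagonal ![(2 : L)⁻¹, -(2 : L)⁻¹]).map (w.1.embedding : L →+* ℂ)))) [μ₂.IsHaarMeasure] :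
    ∃ C : ℝ, C ≠ 0 ∧
      ∀ (f : Matrix (Fin 2) (Fin 2) ℂ → E), ContDiff ℝ 1 f → HasCompactSupport f → ∀ z : Circle,
        Tendsto (fun ψ : ℝ => deriv (fun ψ : ℝ => (2 * Real.sin ψ) •
            ∫ h : unitaryGroupOfForm (starRingEnd ℂ) ((Matrix.diagonal ![(2 : L)⁻¹, -(2 : L)⁻¹]).map (w.1.embedding : L →+* ℂ)),
              f (((h * ⟨circleDiagonal 2 ![z * Circle.exp ψ, z * Circle.exp (-ψ)], circleDiagonal_mem_archLocal_diagonal L 2 ![(2 : L)⁻¹, -(2 : L)⁻¹] w _⟩ * h⁻¹ :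
                unitaryGroupOfForm (starRingEnd ℂ) ((Matrix.diagonal ![(2 : L)⁻¹, -(2 : L)⁻¹]).map (w.1.embedding : L →+* ℂ))) : GL (Fin 2) ℂ) : Matrix (Fin 2) (Fin 2) ℂ) ∂μ₂) ψ)
          (𝓝[≠] 0) (𝓝 (C • f ((z : ℂ) • (1 : Matrix (Fin 2) (Fin 2) ℂ)))) ∧
        ∀ ψ ∈ Ioo (-1 : ℝ) 1, ψ ≠ 0 → DifferentiableAt ℝ (fun ψ : ℝ => (2 * Real.sin ψ) •
            ∫ h : unitaryGroupOfForm (starRingEnd ℂ) ((Matrix.diagonal ![(2 : L)⁻¹, -(2 : L)⁻¹]).map (w.1.embedding : L →+* ℂ)),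
              f (((h * ⟨circleDiagonal 2 ![z * Circle.exp ψ, z * Circle.exp (-ψ)], circleDiagonal_mem_archLocal_diagonal L 2 ![(2 : L)⁻¹, -(2 : L)⁻¹] w _⟩ * h⁻¹ :
                unitaryGroupOfForm (starRingEnd ℂ) ((Matrix.diagonal ![(2 : L)⁻¹, -(2 : L)⁻¹]).map (w.1.embedding : L →+* ℂ))) : GL (Fin 2) ℂ) : Matrix (Fin 2) (Fin 2) ℂ) ∂μ₂) ψ :=
  exists_tendsto_deriv_two_sin_smul_orbitalIntegral (w.1.embedding : L →+* ℂ) ![(2 : L)⁻¹, -(2 : L)⁻¹]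
    (im_embedding_quasiSplitWeightsTwo_eq_zero L w) (re_embedding_quasiSplitWeightsTwo_mul_neg L w) μ₂

end RankOne

end UnitaryGroup

end Literature.NumberTheory.Automorphic

end
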